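import Literature.Geometry.Lorentzian.NullInfinity
import Literature.Geometry.Lorentzian.IsometricImmersionExp
import Literature.Geometry.Lorentzian.RelativeDevelopmentGluingCauchy
import Literature.Geometry.Lorentzian.ConvergenceTransport
import Literature.Geometry.Lorentzian.CauchyDevelopmentOneJet

/-!
# Solo (blind) — transport of causal structure and null infinity along isometries, I

Kernel infrastructure for the isometry invariance of the conclusion of `FinalStateConjecture`
(`SoloBlindInvariance`): for a time-orientation preserving isometry with inverse, images of
`J^±`, `I^±` are `J^±`, `I^±` of images (`soloBlind_image_causalFuture_eq`, …; O'Neill 1983,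
Ch. 14, pp. 402–403); isometries carry maximal geodesics to maximal geodesics
(`soloBlind_isMaximalGeodesicOn_comp`; O'Neill 1983, Ch. 3, pp. 90–91, via
`PseudoRiemannianMetric.IsIsometricImmersion.isGeodesicOn_comp`); the witness type
`SoloBlindIsometry 𝒮₁ 𝒮₂` of `DataEmbedding.IsIsometricTo` with its inverse (`symm`), and the two
transport theorems: an isometry of data embeddings carries normalised null rays from `p` to
normalised null rays from `p` with the same affine domain (`isNormalisedNullRayFrom_comp`, using
`DataEmbedding.mfderiv_normal`), and complete future null infinity in Christodoulou's sojourn-time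
formulation is invariant (`SoloBlindIsometry.hasCompleteFutureNullInfinity`) — the named fact
`Development.hasCompleteFutureNullInfinity_iff_of_isIsometricTo` of `NullInfinity.lean`, there
"vendored as a fact only because the prelude does not yet carry naturality of geodesics under
diffeomorphisms", proved for data embeddings.

References: Y. Choquet-Bruhat, R. Geroch, Comm. Math. Phys. 14 (1969) 329–335, Thm. 3;
B. O'Neill, *Semi-Riemannian geometry*, Academic Press 1983, Ch. 3, pp. 58, 90–91, Ch. 5,
p. 145, Ch. 14, pp. 402–403; J. Sbierski, Ann. Henri Poincaré 17 (2016) 301–329, §2 (the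
isometry class of a GHD is the solution); D. Christodoulou, Class. Quantum Grav. 16 (1999) A23,
pp. A26–A27.
-/

noncomputable section

open Literature.Geometry.Lorentzian TopologicalSpace Manifold Filter Topology Set Function
open scoped ContDiff Topology ENNReal Manifold

universe u

namespace Summit.FinalStateConjecture.FinalStateConjecture.Theorems

/-! ### A. Causal sets and maximal geodesics under isometric immersions -/

section Immersion

variable {E : Type*} [NormedAddCommGroup E] [NormedSpace ℝ E] {H : Type*} [TopologicalSpace H]
  {I : ModelWithCorners ℝ E H} {M : Type*} [TopologicalSpace M] [ChartedSpace H M]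
  [IsManifold I ∞ M]
  {E' : Type*} [NormedAddCommGroup E'] [NormedSpace ℝ E'] {H' : Type*} [TopologicalSpace H']
  {I' : ModelWithCorners ℝ E' H'} {N : Type*} [TopologicalSpace N] [ChartedSpace H' N]
  [IsManifold I' ∞ N]

section Causal

variable {m : ℕ∞ω} {g : LorentzianMetric I m M} {τ : TimeOrientation g}
  {gN : LorentzianMetric I' m N} {τN : TimeOrientation gN}

variable {φ : N → M} {φ' : M → N}

/-- `φ(J⁺(S)) = J⁺(φ(S))` for a time-orientation preserving isometry `φ` with inverse `φ'`
(O'Neill 1983, Ch. 14, pp. 402–403). -/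
theorem soloBlind_image_causalFuture_eq (hφd : MDifferentiable I' I φ)
    (hτ : τN.PreservesTimeOrientation φ τ)
    (hφ : ∀ y, pullbackBilin (I := I) (I' := I') φ g.val y = gN.val y)
    (hφ'd : MDifferentiable I I' φ') (hτ' : τ.PreservesTimeOrientation φ' τN)
    (hφ' : ∀ x, pullbackBilin (I := I') (I' := I) φ' gN.val x = g.val x)
    (h₁ : ∀ y, φ' (φ y) = y) (h₂ : ∀ x, φ (φ' x) = x) (S : Set N) :
    φ '' gN.causalFuture τN S = g.causalFuture τ (φ '' S) := by
  refine (LorentzianMetric.image_causalFuture_subset hφd hτ hφ S).antisymm fun x hx ↦ ?_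
  have h := LorentzianMetric.image_causalFuture_subset hφ'd hτ' hφ' (φ '' S) ⟨x, hx, rfl⟩
  rw [image_image] at h
  simp only [h₁, image_id'] at h
  exact ⟨φ' x, h, h₂ x⟩

/-- `φ(J⁻(S)) = J⁻(φ(S))` for a time-orientation preserving isometry (time dual). -/
theorem soloBlind_image_causalPast_eq (hφd : MDifferentiable I' I φ)
    (hτ : τN.PreservesTimeOrientation φ τ)
    (hφ : ∀ y, pullbackBilin (I := I) (I' := I') φ g.val y = gN.val y)
    (hφ'd : MDifferentiable I I' φ') (hτ' : τ.PreservesTimeOrientation φ' τN)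
    (hφ' : ∀ x, pullbackBilin (I := I') (I' := I) φ' gN.val x = g.val x)
    (h₁ : ∀ y, φ' (φ y) = y) (h₂ : ∀ x, φ (φ' x) = x) (S : Set N) :
    φ '' gN.causalPast τN S = g.causalPast τ (φ '' S) :=
  soloBlind_image_causalFuture_eq hφd hτ.reverse hφ hφ'd hτ'.reverse hφ' h₁ h₂ S

/-- `φ(I⁺(S)) = I⁺(φ(S))` for a time-orientation preserving isometry `φ` with inverse `φ'`:
a timelike curve composed with a time-orientation preserving isometric immersion is timelike
(`IsFutureTimelikeCurveOn.comp_isIsometricImmersion`), applied to `φ` and to `φ'`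
(O'Neill 1983, Ch. 14, p. 403). -/
theorem soloBlind_image_chronologicalFuture_eq (hφd : MDifferentiable I' I φ)
    (hτ : τN.PreservesTimeOrientation φ τ)
    (hφ : ∀ y, pullbackBilin (I := I) (I' := I') φ g.val y = gN.val y)
    (hφ'd : MDifferentiable I I' φ') (hτ' : τ.PreservesTimeOrientation φ' τN)
    (hφ' : ∀ x, pullbackBilin (I := I') (I' := I) φ' gN.val x = g.val x)
    (h₁ : ∀ y, φ' (φ y) = y) (h₂ : ∀ x, φ (φ' x) = x) (S : Set N) :
    φ '' gN.chronologicalFuture τN S = g.chronologicalFuture τ (φ '' S) := by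
  have key₁ : φ '' gN.chronologicalFuture τN S ⊆ g.chronologicalFuture τ (φ '' S) := by
    rintro _ ⟨q, ⟨p, hp, γ, a, b, hab, hγ, hγa, hγb⟩, rfl⟩
    exact ⟨φ p, mem_image_of_mem φ hp, φ ∘ γ, a, b, hab,
      hγ.comp_isIsometricImmersion hφd hτ hφ, by simp [hγa], by simp [hγb]⟩
  have key₂ : φ' '' g.chronologicalFuture τ (φ '' S) ⊆
      gN.chronologicalFuture τN (φ' '' (φ '' S)) := by
    rintro _ ⟨q, ⟨p, hp, γ, a, b, hab, hγ, hγa, hγb⟩, rfl⟩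
    exact ⟨φ' p, mem_image_of_mem φ' hp, φ' ∘ γ, a, b, hab,
      hγ.comp_isIsometricImmersion hφ'd hτ' hφ', by simp [hγa], by simp [hγb]⟩
  refine key₁.antisymm fun x hx ↦ ?_
  have h := key₂ ⟨x, hx, rfl⟩
  rw [image_image] at h
  simp only [h₁, image_id'] at h
  exact ⟨φ' x, h, h₂ x⟩

/-- `φ(I⁻(S)) = I⁻(φ(S))` for a time-orientation preserving isometry (time dual). -/
theorem soloBlind_image_chronologicalPast_eq (hφd : MDifferentiable I' I φ)
    (hτ : τN.PreservesTimeOrientation φ τ)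
    (hφ : ∀ y, pullbackBilin (I := I) (I' := I') φ g.val y = gN.val y)
    (hφ'd : MDifferentiable I I' φ') (hτ' : τ.PreservesTimeOrientation φ' τN)
    (hφ' : ∀ x, pullbackBilin (I := I') (I' := I) φ' gN.val x = g.val x)
    (h₁ : ∀ y, φ' (φ y) = y) (h₂ : ∀ x, φ (φ' x) = x) (S : Set N) :
    φ '' gN.chronologicalPast τN S = g.chronologicalPast τ (φ '' S) :=
  soloBlind_image_chronologicalFuture_eq hφd hτ.reverse hφ hφ'd hτ'.reverse hφ' h₁ h₂ S

end Causal

section Geodesic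

variable [FiniteDimensional ℝ E] [FiniteDimensional ℝ E'] [CompleteSpace E] [CompleteSpace E']
  {gN : PseudoRiemannianMetric I' ∞ E' (TangentSpace I' : N → Type _)}
  {gM : PseudoRiemannianMetric I ∞ E (TangentSpace I : M → Type _)}

/-- **Isometries carry maximal geodesics to maximal geodesics**: if `f : (N, gN) → (M, gM)` is an
isometric immersion with an isometric immersion `f'` as left inverse, and `γ` is a maximal
(inextendible) geodesic of `gN` with domain `s`, then `f ∘ γ` is a maximal geodesic of `gM` with
the same domain (`f ∘ γ` is a geodesic, O'Neill 1983, Ch. 3, pp. 90–91; an extension `γ'` of it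
would pull back to the extension `f' ∘ γ'` of `γ`). -/
theorem soloBlind_isMaximalGeodesicOn_comp [gN.HasLeviCivita] [gM.HasLeviCivita]
    {f : N → M} {f' : M → N}
    (hf : gN.IsIsometricImmersion gM f) (hf' : gM.IsIsometricImmersion gN f')
    (hf'f : ∀ y, f' (f y) = y) (hdim : Module.finrank ℝ E' = Module.finrank ℝ E)
    {γ : ℝ → N} {s : Set ℝ} (hγ : IsMaximalGeodesicOn gN.leviCivita γ s) :
    IsMaximalGeodesicOn gM.leviCivita (f ∘ γ) s := by
  refine ⟨hγ.1, hγ.2.1, (hf.isGeodesicOn_comp hdim hγ.1 hγ.2.2.1).1,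
    fun γ' s' hs'o hs'c hss' hγ' heq ↦ ?_⟩
  refine hγ.2.2.2 (f' ∘ γ') s' hs'o hs'c hss' (hf'.isGeodesicOn_comp hdim.symm hs'o hγ').1
    fun t ht ↦ ?_
  show γ t = f' (γ' t)
  rw [← heq ht, comp_apply, hf'f]

end Geodesic

end Immersion

/-! ### B. Sojourn times under a map -/

/-- The sojourn time of `φ ∘ γ` in `A₂` is the sojourn time of `γ` in `A₁` when
`φ⁻¹(A₂) = A₁`. -/
theorem soloBlind_sojournTime_comp {M₁ M₂ : Type*} (φ : M₁ → M₂) (γ : ℝ → M₁) (dom : Set ℝ)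
    {A₁ : Set M₁} {A₂ : Set M₂} (h : ∀ x, φ x ∈ A₂ ↔ x ∈ A₁) :
    sojournTime (φ ∘ γ) dom A₂ = sojournTime γ dom A₁ := by
  unfold sojournTime
  simp only [comp_apply, h]

/-! ### C. Isometries of data embeddings: the working structure -/

section DataEmbedding

variable {n : ℕ} {X : Type u} [TopologicalSpace X] [ChartedSpace (EuclideanSpace ℝ (Fin n)) X]
  [IsManifold (𝓡 n) ∞ X] [ConnectedSpace X] {D : InitialDataSet (𝓡 n) X}

/-- An **isometry of data embeddings** `𝒮₁ → 𝒮₂` of the same data: a smooth diffeomorphism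
`ψ : M₁ ≃ M₂` with `ψ^* g₂ = g₁`, preserving the time orientations, with `ψ ∘ ι₁ = ι₂` — the
witness type of `DataEmbedding.IsIsometricTo` (Choquet-Bruhat–Geroch 1969, Thm. 3; Sbierski 2016,
§2). -/
structure SoloBlindIsometry (𝒮₁ 𝒮₂ : DataEmbedding D) where
  /-- The underlying diffeomorphism. -/
  toDiffeomorph : Diffeomorph (𝓡 (n + 1)) (𝓡 (n + 1)) 𝒮₁.carrier 𝒮₂.carrier ∞
  /-- `ψ^* g₂ = g₁`. -/
  isIsometry : 𝒮₁.metric.IsIsometry 𝒮₂.metric.toPseudoRiemannianMetric toDiffeomorph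
  /-- `ψ` preserves the time orientations. -/
  preserves : 𝒮₁.timeOrientation.PreservesTimeOrientation toDiffeomorph 𝒮₂.timeOrientation
  /-- `ψ ∘ ι₁ = ι₂`. -/
  comp_embed : ⇑toDiffeomorph ∘ 𝒮₁.embed = 𝒮₂.embed

namespace SoloBlindIsometry

variable {𝒮₁ 𝒮₂ : DataEmbedding D} (Ψ : SoloBlindIsometry 𝒮₁ 𝒮₂)

/-- `IsIsometricTo` is inhabitedness of the witness type. -/
theorem nonempty_iff : Nonempty (SoloBlindIsometry 𝒮₁ 𝒮₂) ↔ 𝒮₁.IsIsometricTo 𝒮₂ :=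
  ⟨fun ⟨Ψ⟩ ↦ ⟨Ψ.toDiffeomorph, Ψ.isIsometry, Ψ.preserves, Ψ.comp_embed⟩,
    fun ⟨ψ, h₁, h₂, h₃⟩ ↦ ⟨⟨ψ, h₁, h₂, h₃⟩⟩⟩

/-- A witness of `IsIsometricTo` (choice). -/
def ofIsIsometricTo (h : 𝒮₁.IsIsometricTo 𝒮₂) : SoloBlindIsometry 𝒮₁ 𝒮₂ :=
  Classical.choice (nonempty_iff.2 h)

/-- `ψ` is differentiable. -/
theorem mdifferentiable : MDifferentiable (𝓡 (n + 1)) (𝓡 (n + 1)) Ψ.toDiffeomorph :=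
  Ψ.toDiffeomorph.contMDiff.mdifferentiable (by simp)

/-- `ψ⁻¹` is differentiable. -/
theorem mdifferentiable_symm : MDifferentiable (𝓡 (n + 1)) (𝓡 (n + 1)) Ψ.toDiffeomorph.symm :=
  Ψ.toDiffeomorph.symm.contMDiff.mdifferentiable (by simp)

/-- `ψ` is an isometric immersion. -/
theorem isIsometricImmersion :
    𝒮₁.metric.IsIsometricImmersion 𝒮₂.metric.toPseudoRiemannianMetric Ψ.toDiffeomorph :=
  ⟨Ψ.toDiffeomorph.contMDiff, Ψ.isIsometry⟩

/-- `ψ (ι₁ x) = ι₂ x`. -/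
theorem apply_embed (x : X) : Ψ.toDiffeomorph (𝒮₁.embed x) = 𝒮₂.embed x :=
  congrFun Ψ.comp_embed x

/-- `g₂(dψ u, dψ w) = g₁(u, w)`. -/
theorem val_mfderiv (y : 𝒮₁.carrier) (u w : TangentSpace (𝓡 (n + 1)) y) :
    𝒮₂.metric.val (Ψ.toDiffeomorph y)
        (mfderiv (𝓡 (n + 1)) (𝓡 (n + 1)) Ψ.toDiffeomorph y u)
        (mfderiv (𝓡 (n + 1)) (𝓡 (n + 1)) Ψ.toDiffeomorph y w) =
      𝒮₁.metric.val y u w := by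
  have h := congrArg (fun b ↦ b u w) (Ψ.isIsometry y)
  simpa only [pullbackBilin_apply] using h

/-- **The inverse isometry** (the inverse of an isometry is an isometry, O'Neill 1983, Ch. 3,
p. 58; it preserves the time orientation, O'Neill 1983, Ch. 5, p. 145; `ψ⁻¹ ∘ ι₂ = ι₁`). The
proof is that of `DataEmbedding.IsIsometricTo.symm`. -/
def symm : SoloBlindIsometry 𝒮₂ 𝒮₁ := by
  refine ⟨Ψ.toDiffeomorph.symm, ?_, ?_, ?_⟩
  · intro z
    have hid : (Ψ.toDiffeomorph : 𝒮₁.carrier → 𝒮₂.carrier) ∘ Ψ.toDiffeomorph.symm = id :=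
      funext Ψ.toDiffeomorph.apply_symm_apply
    have h1 : 𝒮₁.metric.val =
        pullbackBilin (I := 𝓡 (n + 1)) (I' := 𝓡 (n + 1)) Ψ.toDiffeomorph 𝒮₂.metric.val :=
      (funext Ψ.isIsometry).symm
    rw [h1, ← pullbackBilin_comp Ψ.mdifferentiable Ψ.mdifferentiable_symm, hid, pullbackBilin_id]
  · intro z
    have hid : (Ψ.toDiffeomorph : 𝒮₁.carrier → 𝒮₂.carrier) ∘ Ψ.toDiffeomorph.symm = id :=
      funext Ψ.toDiffeomorph.apply_symm_apply
    have hkey : ∀ (w : TangentSpace (𝓡 (n + 1)) z),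
        mfderiv (𝓡 (n + 1)) (𝓡 (n + 1)) Ψ.toDiffeomorph (Ψ.toDiffeomorph.symm z)
          (mfderiv (𝓡 (n + 1)) (𝓡 (n + 1)) Ψ.toDiffeomorph.symm z w) = w := by
      intro w
      have h := mfderiv_comp z (Ψ.mdifferentiable (Ψ.toDiffeomorph.symm z))
        (Ψ.mdifferentiable_symm z)
      rw [hid, mfderiv_id] at h
      exact (congrArg (fun L ↦ L w) h).symm
    refine Ψ.preserves.isFutureDirected_of_mfderiv Ψ.isIsometry ?_
    rw [hkey, Ψ.toDiffeomorph.apply_symm_apply]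
    exact 𝒮₂.timeOrientation.isFutureDirected_vectorField z
  · rw [← Ψ.comp_embed]
    funext x
    simp

/-- The diffeomorphism of the inverse is the inverse diffeomorphism. -/
@[simp]
theorem symm_toDiffeomorph : Ψ.symm.toDiffeomorph = Ψ.toDiffeomorph.symm := rfl

/-- `ψ⁻¹ (ψ y) = y`. -/
theorem symm_apply_apply (y : 𝒮₁.carrier) : Ψ.symm.toDiffeomorph (Ψ.toDiffeomorph y) = y :=
  Ψ.toDiffeomorph.symm_apply_apply y

/-- `ψ (ψ⁻¹ z) = z`. -/
theorem apply_symm_apply (z : 𝒮₂.carrier) : Ψ.toDiffeomorph (Ψ.symm.toDiffeomorph z) = z :=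
  Ψ.toDiffeomorph.apply_symm_apply z

/-- `ψ` is injective. -/
theorem injective : Injective (Ψ.toDiffeomorph : 𝒮₁.carrier → 𝒮₂.carrier) :=
  Function.HasLeftInverse.injective ⟨_, Ψ.symm_apply_apply⟩

/-- `z ∈ ψ(A) ↔ ψ⁻¹ z ∈ A`. -/
theorem mem_image_iff (A : Set 𝒮₁.carrier) (z : 𝒮₂.carrier) :
    z ∈ Ψ.toDiffeomorph '' A ↔ Ψ.symm.toDiffeomorph z ∈ A := by
  constructor
  · rintro ⟨a, ha, rfl⟩
    rwa [Ψ.symm_apply_apply]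
  · exact fun h ↦ ⟨_, h, Ψ.apply_symm_apply z⟩

/-- `range ι₂ = ψ(range ι₁)`. -/
theorem range_embed : range 𝒮₂.embed = Ψ.toDiffeomorph '' range 𝒮₁.embed := by
  rw [← Ψ.comp_embed, range_comp]

/-- `ψ(J⁺₁(S)) = J⁺₂(ψ S)`. -/
theorem image_causalFuture (S : Set 𝒮₁.carrier) :
    Ψ.toDiffeomorph '' 𝒮₁.metric.causalFuture 𝒮₁.timeOrientation S =
      𝒮₂.metric.causalFuture 𝒮₂.timeOrientation (Ψ.toDiffeomorph '' S) :=
  soloBlind_image_causalFuture_eq Ψ.mdifferentiable Ψ.preserves Ψ.isIsometry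
    Ψ.mdifferentiable_symm Ψ.symm.preserves Ψ.symm.isIsometry Ψ.symm_apply_apply
    Ψ.apply_symm_apply S

/-- `ψ(J⁻₁(S)) = J⁻₂(ψ S)`. -/
theorem image_causalPast (S : Set 𝒮₁.carrier) :
    Ψ.toDiffeomorph '' 𝒮₁.metric.causalPast 𝒮₁.timeOrientation S =
      𝒮₂.metric.causalPast 𝒮₂.timeOrientation (Ψ.toDiffeomorph '' S) :=
  soloBlind_image_causalPast_eq Ψ.mdifferentiable Ψ.preserves Ψ.isIsometry
    Ψ.mdifferentiable_symm Ψ.symm.preserves Ψ.symm.isIsometry Ψ.symm_apply_apply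
    Ψ.apply_symm_apply S

/-- `ψ(I⁺₁(S)) = I⁺₂(ψ S)`. -/
theorem image_chronologicalFuture (S : Set 𝒮₁.carrier) :
    Ψ.toDiffeomorph '' 𝒮₁.metric.chronologicalFuture 𝒮₁.timeOrientation S =
      𝒮₂.metric.chronologicalFuture 𝒮₂.timeOrientation (Ψ.toDiffeomorph '' S) :=
  soloBlind_image_chronologicalFuture_eq Ψ.mdifferentiable Ψ.preserves Ψ.isIsometry
    Ψ.mdifferentiable_symm Ψ.symm.preserves Ψ.symm.isIsometry Ψ.symm_apply_apply
    Ψ.apply_symm_apply S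

/-- `ψ(I⁻₁(S)) = I⁻₂(ψ S)`. -/
theorem image_chronologicalPast (S : Set 𝒮₁.carrier) :
    Ψ.toDiffeomorph '' 𝒮₁.metric.chronologicalPast 𝒮₁.timeOrientation S =
      𝒮₂.metric.chronologicalPast 𝒮₂.timeOrientation (Ψ.toDiffeomorph '' S) :=
  soloBlind_image_chronologicalPast_eq Ψ.mdifferentiable Ψ.preserves Ψ.isIsometry
    Ψ.mdifferentiable_symm Ψ.symm.preserves Ψ.symm.isIsometry Ψ.symm_apply_apply
    Ψ.apply_symm_apply S

/-- **Isometries of data embeddings carry normalised null rays to normalised null rays** with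
the same affine domain: `ψ ∘ γ` is a maximal geodesic (O'Neill 1983, Ch. 3, pp. 90–91), starts at
`ψ (ι₁ p) = ι₂ p` with velocity `dψ(γ' 0)`, which is null, future-directed, and normalised against
`dψ(ν₁ p) = ν₂ p` (`DataEmbedding.mfderiv_normal`). Christodoulou, CQG 16 (1999), p. A26. -/
theorem isNormalisedNullRayFrom_comp [𝒮₁.metric.HasLeviCivita] [𝒮₂.metric.HasLeviCivita]
    {p : X} {γ : ℝ → 𝒮₁.carrier} {dom : Set ℝ}
    (hγ : 𝒮₁.metric.IsNormalisedNullRayFrom 𝒮₁.timeOrientation 𝒮₁.embed 𝒮₁.normal p γ dom) :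
    𝒮₂.metric.IsNormalisedNullRayFrom 𝒮₂.timeOrientation 𝒮₂.embed 𝒮₂.normal p
      (Ψ.toDiffeomorph ∘ γ) dom := by
  obtain ⟨hmax, h0, hγ0, hnull, hfd, hnorm⟩ := hγ
  have hgeo := Ψ.isIsometricImmersion.isGeodesicOn_comp rfl hmax.1 hmax.2.2.1
  have hvel : velocity (𝓡 (n + 1)) (Ψ.toDiffeomorph ∘ γ) 0 =
      mfderiv (𝓡 (n + 1)) (𝓡 (n + 1)) Ψ.toDiffeomorph (γ 0) (velocity (𝓡 (n + 1)) γ 0) :=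
    hgeo.2 0 h0
  refine ⟨soloBlind_isMaximalGeodesicOn_comp Ψ.isIsometricImmersion Ψ.symm.isIsometricImmersion
      Ψ.symm_apply_apply rfl hmax, h0, ?_, ?_, ?_, ?_⟩
  · show Ψ.toDiffeomorph (γ 0) = 𝒮₂.embed p
    rw [hγ0, Ψ.apply_embed]
  · rw [hvel]
    refine ⟨?_, fun h ↦ hnull.2 ?_⟩
    · show 𝒮₂.metric.val (Ψ.toDiffeomorph (γ 0))
          (mfderiv (𝓡 (n + 1)) (𝓡 (n + 1)) Ψ.toDiffeomorph (γ 0) (velocity (𝓡 (n + 1)) γ 0))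
          (mfderiv (𝓡 (n + 1)) (𝓡 (n + 1)) Ψ.toDiffeomorph (γ 0) (velocity (𝓡 (n + 1)) γ 0)) = 0
      rw [Ψ.val_mfderiv]
      exact hnull.1
    · exact (injective_iff_map_eq_zero _).1 (Ψ.isIsometricImmersion.injective_mfderiv (γ 0)) _ h
  · rw [hvel]
    exact Ψ.preserves.isFutureDirected_mfderiv Ψ.isIsometry hfd
  · rw [hvel, ← 𝒮₁.mfderiv_normal 𝒮₂ Ψ.isIsometricImmersion Ψ.preserves Ψ.comp_embed p]
    have key : ∀ (x : 𝒮₁.carrier) (hx : x = 𝒮₁.embed p) (u w : TangentSpace (𝓡 (n + 1)) x),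
        𝒮₂.metric.val (𝒮₂.embed p) (mfderiv (𝓡 (n + 1)) (𝓡 (n + 1)) Ψ.toDiffeomorph x u)
          (mfderiv (𝓡 (n + 1)) (𝓡 (n + 1)) Ψ.toDiffeomorph (𝒮₁.embed p) w) =
        𝒮₁.metric.val (𝒮₁.embed p) u w := by
      rintro x rfl u w
      rw [← Ψ.apply_embed p, Ψ.val_mfderiv]
    rw [key (γ 0) hγ0]
    exact hnorm

include Ψ in
/-- **Complete future null infinity is invariant under isometries of data embeddings**: `ψ⁻¹`
carries the normalised null rays of `𝒮₂` from `p` to those of `𝒮₁` from `p` with the same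
affine domain, and `ψ⁻¹(J⁺₂(ι₂ B₀)) = J⁺₁(ι₁ B₀)`, so sojourn times agree. This is the named fact
`Development.hasCompleteFutureNullInfinity_iff_of_isIsometricTo` of `NullInfinity.lean`, proved,
for data embeddings. Christodoulou, CQG 16 (1999), pp. A26–A27. -/
theorem hasCompleteFutureNullInfinity [𝒮₁.metric.HasLeviCivita] [𝒮₂.metric.HasLeviCivita]
    (h : 𝒮₁.metric.HasCompleteFutureNullInfinity 𝒮₁.timeOrientation 𝒮₁.embed 𝒮₁.normal) :
    𝒮₂.metric.HasCompleteFutureNullInfinity 𝒮₂.timeOrientation 𝒮₂.embed 𝒮₂.normal := by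
  obtain ⟨B₀, hB₀, hs⟩ := h
  refine ⟨B₀, hB₀, fun s hs0 ↦ ?_⟩
  obtain ⟨B₁, hB₁, hp⟩ := hs s hs0
  refine ⟨B₁, hB₁, fun p hp₁ γ dom hγ ↦ ?_⟩
  rcases hp p hp₁ (Ψ.symm.toDiffeomorph ∘ γ) dom (Ψ.symm.isNormalisedNullRayFrom_comp hγ) with
    h | h
  · exact Or.inl h
  · refine Or.inr (h.trans_eq (soloBlind_sojournTime_comp _ γ dom fun z ↦ ?_))
    rw [← Ψ.mem_image_iff, Ψ.image_causalFuture, ← image_comp, Ψ.comp_embed]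

end SoloBlindIsometry

end DataEmbedding

end Summit.FinalStateConjecture.FinalStateConjecture.Theorems

end
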